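import Literature.MathematicalPhysics.QuantumFieldTheory.Balaban1983to89.B9Cor36GpDirExtAtField

/-!
# `Balaban1983to89.B9Cor36GpDirBoundaryLetters` — [Balaban1985BackgroundPropagators] Cor. 3.6 p. 408 ∕ p. 394 ON ROAD P4: THE ALGEBRA OF THE DIRICHLET LETTER
# `G′_□(U) = Ω₀(padΔ_{□,Ω₀}(U))⁻¹Ω₀ = (padΔ_{□,Ω₀}(U))⁻¹ − (1 − Ω₀)` AND THE BOUNDARY LETTERS OF ITS FOUR (3.42) WORDS (the flux across `∂Ω₀(□)` — rows of cube
# level `0`), with the site-local bounds feeding [4]'s majorant calculus — sub-row G-B9-LETTERS (site sector), seat dag-n06-c g32 UNIT 8a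

statement-level skeleton of published theorems with citation tags; proofs where landed; nothing here is a claim about the Yang–Mills mass gap

CITATION HEADER (lean-in-tree rule).  B9 = T. Bałaban, *Propagators for lattice gauge theories in a background field*, Commun. Math. Phys. **99** (1985)
389–434 [Balaban1985BackgroundPropagators] (held `paper:balaban1985-cmp99-background-propagators`; journal page = PDF page + 388): p. 394 l. 24–33 («Let us
introduce also the operators Δ′_a, Δ_a with Dirichlet boundary conditions on Ω₀, e.g., Δ′_a↾Ω₀ = Ω₀Δ′_aΩ₀ … Its inverse is denoted by G′, or G′(U)»; l. 31–32 «They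
depend on the configuration U restricted to Ω₀.»); p. 410 l. 14–15 («A propagator G′_□ depends on U restricted to Ω₀(□) ⊂ □̃⁵, and the operator K(h_□) is semi-local»);
Cor. 3.6 p. 408 l. 10–11 («This follows from Corollary 3.5 applied to the configuration U′ = Uᵘ, and we have to recall only that all the results of these theorems are
gauge invariant.»); Thm 3.1 (3.42) p. 397 (the four entries `|G′|, |∇G′|, |G′∇*|, |Δ G′|`); (3.3) p. 390, (3.8) p. 392 (`∇_U`, `∇*_U`);
(3.23)–(3.24) p. 394 (`Δ_U`, `Δ′_a`); p. 408 (last lines) – p. 409 l. 5 («dist(Ω_n(□)ᶜ, Ω_{n+1}(□)) = 2R₀M₀Lⁿη … Ω₀(□) ⊂ □⁵»).  [4] = [Balaban1984PropagatorsII]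
(2.51)–(2.55) p. 232 (block majorants, products, block-diagonal factors).  Rows B9.Cor3.6 × B9.Thm3.1 (cells only; no row head changes).

WHY THIS FILE (road P4 of the N06 h36b campaign; UNITS 1–7 of this seat).  The head's displayed estimate row `h36b` asks for the four (3.42) entries of
`O := G′_□(U) = Ω₀·(padΔ_{□,Ω₀}(U))⁻¹·Ω₀` (E's `GpDirY`) with the derivatives `∇_U`, `∇*_U`, `Δ_U` of the WHOLE torus.  UNIT 7 controls the padded inverse
`(padΔ_{□,Ω₀}(Ṽ))⁻¹ = (padΔ_{□,Ω₀}(Uᵘ))⁻¹` (Theorem 3.4 at the small field).  This file supplies the algebra between the two and the letters of the difference: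
(§2) since `padΔ·(1 − Ω₀) = (1 − Ω₀) = (1 − Ω₀)·padΔ`, the Dirichlet letter IS `O = (padΔ)⁻¹ − (1 − Ω₀)` — so every word in `O` is the corresponding word in the padded
inverse minus a BOUNDARY WORD supported on the rows off `Ω₀(□)` (cube level `0`, where `η = L⁰η` is the block length): `∇_{U,μ}·η²(1 − Ω₀) = ηR(U_μ)σ_μ(1 − Ω₀) − η(1 − Ω₀)`,
`η²(1 − Ω₀)·(−∇*_{U,μ}) = η(1 − Ω₀) − η(1 − Ω₀)R(U_μ(·−e_μ))⁻¹σ_{−μ}`, and for the Laplacian `Δ_U·O = Ω₀ − Ω₀·(avg)·O + (1 − Ω₀)Δ_U O` with the flux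
`(1 − Ω₀)Δ_U O = −Σ_μ (1 − Ω₀)(R(U_μ(·−e_μ))⁻¹σ_{−μ} + R(U_μ)σ_μ)O` (`O` vanishes off `Ω₀`; E's `Ω₀Δ′_{a,□}O = Ω₀`); (§1) the site-local letters `r(1 − Ω₀)`, `rR(U_μ)`,
`rR(U_μ(·−e_μ))⁻¹` with their row bounds (bi-contractive `R`); (§3) the (3.70)-defect multipliers `η⁻¹(R(U_μ) − 1)` are `≤ 2(L^{n}η)⁻¹` on EVERY row — `5α₁(Lⁿη)⁻¹` on the
bonds inside `Ω₀(□)` where `Uᵘ = e^{iηA}` is small (r05's `norm_mulDefF_apply_le`, generalised from `locCfgY` to any `e^{iηA′}`-valued bond), `2η⁻¹` on the level-`0` rows —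
and the averaging operator of `Δ′_{a,□}` at the knit legs does not see the difference between `Ṽ` and `Uᵘ` (§3, from UNIT 6).  UNIT 8b assembles the four entries.

WHAT IS PROVED (5 `def`s with bodies — `exMul`, `rotF`, `rotB` (§1) and the abbreviations `avgOpY`, `GinvY` (§2); 0 sorry; 0 new named facts; standard axioms): see the
section headers; the main identities are ★`GpDirY_eq_GinvY_sub` (`O = (padΔ)⁻¹ − (1 − Ω₀)`), ★`diffLetter_inl_mul_exMul`, ★`exMul_mul_diffLetter_inr`, ★`lapSL_mul_GpDirY`,
★`exMul_lapSL_GpDirY` (the flux), ★`norm_mulDefF/B_apply_le_of_fluct/_of_lev_zero`, ★`avgOpY_cutCfgS_eq_gaugeY`.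

DIFFERENCE FROM NEIGHBOURS: `B9Cor36GpCubeEntriesAtV` (r05 FILE 7b) treats the WHOLE-torus letter `G′_□(Ṽ) = (Δ′_{a,□}(Ṽ))⁻¹` at the `parSymY` legs (no boundary, no
`Ω₀`); `B9Cor35GpDirInputsAtOne` §3 (UNIT 1) has the exterior-row majorants of the REAL matrices `(1 − 𝟙_S)`, `∂(1 − 𝟙_S)` at `U = 1` (used for the padded kernel at the
base); here the boundary words carry the rotations `R(U_μ)` of an arbitrary bi-contractive configuration and are bounded through [4]'s row-local calculus
(`B9Cor36SiteSandwichTransfer` §1).  Print locus: p. 394 + Cor. 3.6; the decomposition `O = (padΔ)⁻¹ − (1 − Ω₀)` is bookkeeping of p. 394's definition.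
-/

noncomputable section

namespace Literature.MathematicalPhysics.QuantumFieldTheory.Balaban1983to89.B9Cor36GpDirBoundaryLetters

open Literature.MathematicalPhysics.QuantumFieldTheory.Balaban1983to89
open Literature.MathematicalPhysics.QuantumFieldTheory.Balaban1983to89.B9Eq352DivFormLetters (conj conj_sub conj_mul coordEquiv gradLetterF_apply gradLetterB_apply)
open Literature.MathematicalPhysics.QuantumFieldTheory.Balaban1983to89.B9Eq352GradLetters (diffLetter diffLetter_inl diffLetter_inr conj_add)
open Literature.MathematicalPhysics.QuantumFieldTheory.Balaban1983to89.B9Eq39Adjoint (R R_add R_sub R_zero R_smul R_inv_R fluct covD covDstar)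
open Literature.MathematicalPhysics.QuantumFieldTheory.Balaban1983to89.B9Eq352DivForm (tauB)
open Literature.MathematicalPhysics.QuantumFieldTheory.Balaban1983to89.B6KLevelCensusIndexV1 (KIdx kGeo)
open Literature.MathematicalPhysics.QuantumFieldTheory.Balaban1983to89.B6Cover236MultiLevelBlocks (cubes)
open Literature.MathematicalPhysics.QuantumFieldTheory.Balaban1983to89.B6GlobalChartV1 (PV boxEquiv)
open Literature.MathematicalPhysics.QuantumFieldTheory.Balaban1983to89.B6Geom246MultiLevelBoxL0 (blkOf)
open Literature.MathematicalPhysics.QuantumFieldTheory.Balaban1983to89.B9Eq360DeltaPrimeAY (mulY AfldY chartA chartA_apply)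
open Literature.MathematicalPhysics.QuantumFieldTheory.Balaban1983to89.B9Eq360DeltaPrimeACubeY (blkCubeY levCubeY_eq)
open Literature.MathematicalPhysics.QuantumFieldTheory.Balaban1983to89.B9CubeLettersOpsL0 (cubeFamY levCubeY avgCoeffCubeY avgTrCubeY deltaPrimeACubeY)
open Literature.MathematicalPhysics.QuantumFieldTheory.Balaban1983to89.B9CubeLettersBondOpsL0 (BlkCubeY)
open Literature.MathematicalPhysics.QuantumFieldTheory.Balaban1983to89.B9CubeGeometryInputs (geoCK geoCK_len geoCK_eta geoCK_eta_pos geoCK_len_pos geoCK_len_blkCubeY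
  geoCK_eta_le_len)
open Literature.MathematicalPhysics.QuantumFieldTheory.Balaban1983to89.B9Cor36GpCubeEntriesAtV (shiftOpY shiftOpY' mulDefF mulDefB mulDefF_apply mulDefB_apply
  norm_R_sub_self_le_of_small)
open Literature.MathematicalPhysics.QuantumFieldTheory.Balaban1983to89.B9Eq337CutFieldDirY (cutFldS cutCfgS UboxY_cutCfgS UboxY_cutCfgS_of_mem)
open Literature.MathematicalPhysics.QuantumFieldTheory.Balaban1983to89.B9Thm311CubeLettersFirstThree (levCubeY_eq_of_blkOf_eq)
open Literature.MathematicalPhysics.QuantumFieldTheory.Balaban1983to89.B9Eq359CubeKernelsKnitAtOne (blkCubeY_eq_of_avgCoeffCubeY_ne_zero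
  avgTrCubeY_parKnitCubeY_congr_of_agree_block)
open Literature.MathematicalPhysics.QuantumFieldTheory.Balaban1983to89.B9Eq360PadDeltaCubeYAgree (lapS_term_apply knitCubeY_of_levCubeY_eq_zero)
open Literature.MathematicalPhysics.QuantumFieldTheory.Balaban1983to89.Node00 (SiteY CfgY GaugeY SiteParY toKT shiftY UboxY lapS cdS cdsS gaugeY lapSL lapSL_apply
  kernelTrOpY kernelTrOpY_apply)
open Literature.MathematicalPhysics.QuantumFieldTheory.Balaban1983to89.Node00.OpsYLocalInverse (cubeProjY cubeProjY_apply cubeProjY_mul_cubeProjY dirPadY)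
open Literature.MathematicalPhysics.QuantumFieldTheory.Balaban1983to89.Node00.OpsYCubeDirInverse (padDeltaCubeY GpDirY GpDirY_def GpDirY_apply_eq_zero
  cubeProjY_mul_deltaPrimeACubeY_mul_GpDirY)
open Literature.MathematicalPhysics.QuantumFieldTheory.Balaban1983to89.Node00.OpsYCubeKnitPar (parKnitCubeY knitCubeY avgTrCubeY_parKnitCubeY)
open scoped Matrix

variable {d ℓ : ℕ} {hd : 1 ≤ d + 1} {hL : Odd (ℓ + 1) ∧ 1 < ℓ + 1} {b₀ b₁ : ℝ}
variable {𝔸 : Type} [NormedRing 𝔸] [NormedAlgebra ℂ 𝔸] [CompleteSpace 𝔸]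

/-! ## §1  Site-local letters: the exterior indicator `r(1 − Ω₀)` and the bond rotations `rR(U_μ)`, `rR(U_μ(· − e_μ))⁻¹`; their row bounds -/

section Local

variable (i : KIdx d ℓ hd hL b₀ b₁)

/-- **`r·(1 − Ω₀)`** on the `𝔸`-valued site functions: `f ↦ (z ↦ r f(z))` off `S`, `0` on `S` (real `r`). [cite: Balaban1985BackgroundPropagators, p.394 («Ω₀ denotes a characteristic function»), dictionary] -/
def exMul (S : Finset (SiteY i)) (r : ℝ) : Module.End ℝ (SiteY i → 𝔸) where
  toFun f := fun z => if z ∈ S then 0 else r • f z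
  map_add' f g := by
    funext z
    simp only [Pi.add_apply]
    split_ifs
    · rw [add_zero]
    · rw [smul_add]
  map_smul' s f := by
    funext z
    simp only [Pi.smul_apply, RingHom.id_apply]
    split_ifs
    · rw [smul_zero]
    · rw [smul_comm]

omit [CompleteSpace 𝔸] in
/-- `exMul` applied. [cite: Balaban1985BackgroundPropagators, p.394, bookkeeping] -/
@[simp] theorem exMul_apply (S : Finset (SiteY i)) (r : ℝ) (f : SiteY i → 𝔸) (z : SiteY i) :
    exMul i S r f z = if z ∈ S then 0 else r • f z := rfl

/-- **the forward bond rotation `f ↦ (z ↦ r·R(U_μ(z))f(z))`** (site-local; the rotation inside `∇_{U,μ}`, (3.3)). [cite: Balaban1985BackgroundPropagators, (3.3) p.390, dictionary] -/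
def rotF (V : CfgY 𝔸 i) (r : ℝ) (μ : Fin (d + 1)) : Module.End ℝ (SiteY i → 𝔸) where
  toFun f := fun z => r • R (UboxY i V μ z) (f z)
  map_add' f g := by
    funext z
    simp only [Pi.add_apply, R_add, smul_add]
  map_smul' s f := by
    funext z
    simp only [Pi.smul_apply, RingHom.id_apply]
    rw [← Complex.coe_smul s (f z), R_smul, Complex.coe_smul, smul_comm]

/-- **the backward bond rotation `f ↦ (z ↦ r·R(U_μ(z − e_μ))⁻¹f(z))`** (site-local; the rotation inside `∇*_{U,μ}`, (3.8)). [cite: Balaban1985BackgroundPropagators, (3.8) p.392, dictionary] -/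
def rotB (V : CfgY 𝔸 i) (r : ℝ) (μ : Fin (d + 1)) : Module.End ℝ (SiteY i → 𝔸) where
  toFun f := fun z => r • R (UboxY i V μ ((shiftY i μ).symm z))⁻¹ (f z)
  map_add' f g := by
    funext z
    simp only [Pi.add_apply, R_add, smul_add]
  map_smul' s f := by
    funext z
    simp only [Pi.smul_apply, RingHom.id_apply]
    rw [← Complex.coe_smul s (f z), R_smul, Complex.coe_smul, smul_comm]

/-- `rotF` applied. [cite: Balaban1985BackgroundPropagators, (3.3) p.390, bookkeeping] -/
@[simp] theorem rotF_apply (V : CfgY 𝔸 i) (r : ℝ) (μ : Fin (d + 1)) (f : SiteY i → 𝔸) (z : SiteY i) :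
    rotF i V r μ f z = r • R (UboxY i V μ z) (f z) := rfl

/-- `rotB` applied. [cite: Balaban1985BackgroundPropagators, (3.8) p.392, bookkeeping] -/
@[simp] theorem rotB_apply (V : CfgY 𝔸 i) (r : ℝ) (μ : Fin (d + 1)) (f : SiteY i → 𝔸) (z : SiteY i) :
    rotB i V r μ f z = r • R (UboxY i V μ ((shiftY i μ).symm z))⁻¹ (f z) := rfl

omit [CompleteSpace 𝔸] in
/-- `(1 − Ω₀)` as a real-linear letter: `((1 − Ω₀)|_ℝ) = exMul 1`. [cite: Balaban1985BackgroundPropagators, p.394, bookkeeping] -/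
theorem restrictScalars_one_sub_cubeProjY (S : Finset (SiteY i)) :
    ((1 - cubeProjY (𝔸 := 𝔸) i S).restrictScalars ℝ : Module.End ℝ (SiteY i → 𝔸)) = exMul i S 1 := by
  refine LinearMap.ext fun f => funext fun z => ?_
  rw [LinearMap.restrictScalars_apply, exMul_apply, LinearMap.sub_apply, Module.End.one_apply, Pi.sub_apply, cubeProjY_apply]
  split_ifs
  · exact sub_self _
  · rw [sub_zero, one_smul]

omit [CompleteSpace 𝔸] in
/-- `r(1 − Ω₀)` kills the rows in `S` and is bounded by `|r|κ` for any weight `κ ≥ 0` with `κ ≥ 1` off `S`. [cite: Balaban1985BackgroundPropagators, p.394; Balaban1984PropagatorsII, (2.52) p.232] -/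
theorem norm_exMul_apply_le {S : Finset (SiteY i)} (r : ℝ) (κ : SiteY i → ℝ) (hκ0 : ∀ z, 0 ≤ κ z) (hκ : ∀ z, z ∉ S → 1 ≤ κ z) (f : SiteY i → 𝔸)
    (z : SiteY i) : ‖exMul i S r f z‖ ≤ |r| * κ z * ‖f z‖ := by
  rw [exMul_apply]
  split_ifs with hz
  · rw [norm_zero]; exact mul_nonneg (mul_nonneg (abs_nonneg r) (hκ0 z)) (norm_nonneg _)
  · rw [norm_smul, Real.norm_eq_abs]
    calc |r| * ‖f z‖ = |r| * 1 * ‖f z‖ := by rw [mul_one]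
      _ ≤ |r| * κ z * ‖f z‖ := mul_le_mul_of_nonneg_right (mul_le_mul_of_nonneg_left (hκ z hz) (abs_nonneg r)) (norm_nonneg _)

omit [CompleteSpace 𝔸] in
/-- in particular `‖(r(1 − Ω₀)f)(z)‖ ≤ |r|‖f(z)‖`. [cite: Balaban1985BackgroundPropagators, p.394, bookkeeping] -/
theorem norm_exMul_apply_le' {S : Finset (SiteY i)} (r : ℝ) (f : SiteY i → 𝔸) (z : SiteY i) : ‖exMul i S r f z‖ ≤ |r| * ‖f z‖ := by
  have h := norm_exMul_apply_le i (S := S) r (fun _ => (1 : ℝ)) (fun _ => zero_le_one) (fun _ _ => le_rfl) f z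
  rwa [mul_one] at h

omit [CompleteSpace 𝔸] in
/-- scalars move into `exMul`. [cite: Balaban1985BackgroundPropagators, p.394, bookkeeping] -/
theorem smul_exMul (S : Finset (SiteY i)) (s r : ℝ) : s • exMul (𝔸 := 𝔸) i S r = exMul i S (s * r) := by
  refine LinearMap.ext fun f => funext fun z => ?_
  rw [LinearMap.smul_apply, Pi.smul_apply, exMul_apply, exMul_apply]
  split_ifs
  · rw [smul_zero]
  · rw [smul_smul]

/-- `‖(rR(U_μ)f)(z)‖ ≤ |r|‖f(z)‖` for a contractive rotation. [cite: Balaban1985BackgroundPropagators, (3.3) p.390, (3.35) p.396 (G-valued U)] -/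
theorem norm_rotF_apply_le {V : CfgY 𝔸 i} {μ : Fin (d + 1)} {z : SiteY i} (hR : ∀ a : 𝔸, ‖R (UboxY i V μ z) a‖ ≤ ‖a‖) (r : ℝ) (f : SiteY i → 𝔸) :
    ‖rotF i V r μ f z‖ ≤ |r| * ‖f z‖ := by
  rw [rotF_apply, norm_smul, Real.norm_eq_abs]; exact mul_le_mul_of_nonneg_left (hR _) (abs_nonneg r)

/-- `‖(rR(U_μ(z − e_μ))⁻¹f)(z)‖ ≤ |r|‖f(z)‖` for a contractive rotation. [cite: Balaban1985BackgroundPropagators, (3.8) p.392, (3.35) p.396 (G-valued U)] -/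
theorem norm_rotB_apply_le {V : CfgY 𝔸 i} {μ : Fin (d + 1)} {z : SiteY i} (hR : ∀ a : 𝔸, ‖R (UboxY i V μ ((shiftY i μ).symm z))⁻¹ a‖ ≤ ‖a‖) (r : ℝ)
    (f : SiteY i → 𝔸) : ‖rotB i V r μ f z‖ ≤ |r| * ‖f z‖ := by
  rw [rotB_apply, norm_smul, Real.norm_eq_abs]; exact mul_le_mul_of_nonneg_left (hR _) (abs_nonneg r)

omit [CompleteSpace 𝔸] in
/-- `σ_μ` applied. [cite: Balaban1985BackgroundPropagators, (3.3) p.390, bookkeeping] -/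
theorem shiftOpY_rs_apply (μ : Fin (d + 1)) (f : SiteY i → 𝔸) (z : SiteY i) :
    (shiftOpY (𝔸 := 𝔸) i μ).restrictScalars ℝ f z = f (shiftY i μ z) := rfl

omit [CompleteSpace 𝔸] in
/-- `σ_{−μ}` applied. [cite: Balaban1985BackgroundPropagators, (3.8) p.392, bookkeeping] -/
theorem shiftOpY'_rs_apply (μ : Fin (d + 1)) (f : SiteY i → 𝔸) (z : SiteY i) :
    (shiftOpY' (𝔸 := 𝔸) i μ).restrictScalars ℝ f z = f ((shiftY i μ).symm z) := rfl

omit [CompleteSpace 𝔸] in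
/-- `η⁻¹·(η²·x) = η·x` across the real/complex scalars (private helper). [folklore] -/
private theorem inv_smul_sq_smul (η : ℝ) (x : 𝔸) : (((η : ℂ))⁻¹) • ((η ^ 2 : ℝ) • x) = (η : ℝ) • x := by
  rw [← Complex.coe_smul, smul_smul, ← Complex.coe_smul]
  congr 1
  push_cast
  field_simp

end Local

/-! ## §2  The Dirichlet letter is the padded inverse minus the exterior identity; the boundary words of its four (3.42) products -/

section Algebra

variable (i : KIdx d ℓ hd hL b₀ b₁) (c : ↥(cubes (toKT i).D.toDomains)) (par : SiteParY 𝔸 i) (S : Finset (SiteY i))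

/-- the averaging operator `Σ_n a_n(Lⁿη)⁻² Q′*_□(U)Q′_□(U)` of `Δ′_{a,□}(U)` (E's transported kernel operator). [cite: Balaban1985BackgroundPropagators, (3.24) p.394, dictionary] -/
abbrev avgOpY (U : CfgY 𝔸 i) : Module.End ℂ (SiteY i → 𝔸) := kernelTrOpY (avgCoeffCubeY i c) (avgTrCubeY i c par U)

/-- the padded inverse `(padΔ_{□,Ω₀}(U))⁻¹` (`Ring.inverse`; `0` off the unit locus). [cite: Balaban1985BackgroundPropagators, p.394 («Its inverse is denoted by G′»), dictionary] -/
abbrev GinvY (U : CfgY 𝔸 i) : Module.End ℂ (SiteY i → 𝔸) := Ring.inverse (padDeltaCubeY i c par S U)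

/-- `Δ′_{a,□}(U) = Δ_U + (averaging operator)`. [cite: Balaban1985BackgroundPropagators, (3.24) p.394] -/
theorem deltaPrimeACubeY_eq_add (U : CfgY 𝔸 i) : deltaPrimeACubeY i c par U = lapSL i U + avgOpY i c par U := rfl

/-- `padΔ_{□,Ω₀}(U) = Ω₀Δ′_{a,□}(U)Ω₀ + (1 − Ω₀)`. [cite: Balaban1985BackgroundPropagators, p.394 («Ω₀Δ′_aΩ₀»)] -/
theorem padDeltaCubeY_eq (U : CfgY 𝔸 i) :
    padDeltaCubeY i c par S U = cubeProjY i S * deltaPrimeACubeY i c par U * cubeProjY i S + (1 - cubeProjY i S) := rfl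

/-- `padΔ·(1 − Ω₀) = 1 − Ω₀`. [cite: Balaban1985BackgroundPropagators, p.394, bookkeeping] -/
theorem padDeltaCubeY_mul_one_sub (U : CfgY 𝔸 i) : padDeltaCubeY i c par S U * (1 - cubeProjY i S) = 1 - cubeProjY i S := by
  have hP := cubeProjY_mul_cubeProjY (𝔸 := 𝔸) i S
  rw [padDeltaCubeY_eq]
  set P := cubeProjY (𝔸 := 𝔸) i S
  set T := deltaPrimeACubeY i c par U
  have hQQ : (1 - P) * (1 - P) = 1 - P := by rw [sub_mul, one_mul, mul_sub, mul_one, hP, sub_self, sub_zero]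
  have hA : P * T * P * (1 - P) = 0 := by rw [mul_sub, mul_one, mul_assoc (P * T) P P, hP, sub_self]
  calc (P * T * P + (1 - P)) * (1 - P) = P * T * P * (1 - P) + (1 - P) * (1 - P) := add_mul _ _ _
    _ = 1 - P := by rw [hA, hQQ, zero_add]

/-- `(1 − Ω₀)·padΔ = 1 − Ω₀`. [cite: Balaban1985BackgroundPropagators, p.394, bookkeeping] -/
theorem one_sub_mul_padDeltaCubeY (U : CfgY 𝔸 i) : (1 - cubeProjY i S) * padDeltaCubeY i c par S U = 1 - cubeProjY i S := by
  have hP := cubeProjY_mul_cubeProjY (𝔸 := 𝔸) i S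
  rw [padDeltaCubeY_eq]
  set P := cubeProjY (𝔸 := 𝔸) i S
  set T := deltaPrimeACubeY i c par U
  have hQQ : (1 - P) * (1 - P) = 1 - P := by rw [sub_mul, one_mul, mul_sub, mul_one, hP, sub_self, sub_zero]
  have hA : (1 - P) * (P * T * P) = 0 := by rw [sub_mul, one_mul, ← mul_assoc P (P * T) P, ← mul_assoc P P T, hP, sub_self]
  calc (1 - P) * (P * T * P + (1 - P)) = (1 - P) * (P * T * P) + (1 - P) * (1 - P) := mul_add _ _ _
    _ = 1 - P := by rw [hA, hQQ, zero_add]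

variable {S}

/-- `(padΔ)⁻¹·(1 − Ω₀) = 1 − Ω₀` on the regime. [cite: Balaban1985BackgroundPropagators, p.394, bookkeeping] -/
theorem GinvY_mul_one_sub {U : CfgY 𝔸 i} (hU : IsUnit (padDeltaCubeY i c par S U)) : GinvY i c par S U * (1 - cubeProjY i S) = 1 - cubeProjY i S := by
  calc GinvY i c par S U * (1 - cubeProjY i S) = GinvY i c par S U * (padDeltaCubeY i c par S U * (1 - cubeProjY i S)) := by
        rw [padDeltaCubeY_mul_one_sub]
    _ = GinvY i c par S U * padDeltaCubeY i c par S U * (1 - cubeProjY i S) := (mul_assoc _ _ _).symm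
    _ = 1 - cubeProjY i S := by rw [Ring.inverse_mul_cancel _ hU, one_mul]

/-- `(1 − Ω₀)·(padΔ)⁻¹ = 1 − Ω₀` on the regime. [cite: Balaban1985BackgroundPropagators, p.394, bookkeeping] -/
theorem one_sub_mul_GinvY {U : CfgY 𝔸 i} (hU : IsUnit (padDeltaCubeY i c par S U)) : (1 - cubeProjY i S) * GinvY i c par S U = 1 - cubeProjY i S := by
  calc (1 - cubeProjY i S) * GinvY i c par S U = (1 - cubeProjY i S) * padDeltaCubeY i c par S U * GinvY i c par S U := by
        rw [one_sub_mul_padDeltaCubeY]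
    _ = (1 - cubeProjY i S) * (padDeltaCubeY i c par S U * GinvY i c par S U) := mul_assoc _ _ _
    _ = 1 - cubeProjY i S := by rw [Ring.mul_inverse_cancel _ hU, mul_one]

/-- ★★ **THE DIRICHLET LETTER IS THE PADDED INVERSE MINUS THE EXTERIOR IDENTITY: `G′_□(U) = (padΔ_{□,Ω₀}(U))⁻¹ − (1 − Ω₀)`** (on the regime).
[cite: Balaban1985BackgroundPropagators, p.394 («Δ′_a↾Ω₀ = Ω₀Δ′_aΩ₀ … Its inverse is denoted by G′»), bookkeeping] -/
theorem GpDirY_eq_GinvY_sub {U : CfgY 𝔸 i} (hU : IsUnit (padDeltaCubeY i c par S U)) :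
    GpDirY i c par S U = GinvY i c par S U - (1 - cubeProjY i S) := by
  have hP := cubeProjY_mul_cubeProjY (𝔸 := 𝔸) i S
  have h1 := GinvY_mul_one_sub i c par hU
  have h2 := one_sub_mul_GinvY i c par hU
  rw [GpDirY_def]
  change cubeProjY i S * GinvY i c par S U * cubeProjY i S = _
  set P := cubeProjY (𝔸 := 𝔸) i S
  set G := GinvY i c par S U
  have hGP : G * P = G - (1 - P) := by
    rw [mul_sub, mul_one] at h1
    rw [← h1, sub_sub_cancel]
  have hPG : P * G = G - (1 - P) := by
    rw [sub_mul, one_mul] at h2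
    rw [← h2, sub_sub_cancel]
  calc P * G * P = (G - (1 - P)) * P := by rw [hPG]
    _ = G * P - (1 - P) * P := sub_mul _ _ _
    _ = G - (1 - P) - (1 - P) * P := by rw [hGP]
    _ = G - (1 - P) := by rw [sub_mul, one_mul, hP, sub_self, sub_zero]

/-- hence, as real-linear letters, `η²G′_□(U) = η²(padΔ)⁻¹ − η²(1 − Ω₀)`. [cite: Balaban1985BackgroundPropagators, p.394, bookkeeping] -/
theorem smul_GpDirY_restrict {U : CfgY 𝔸 i} (hU : IsUnit (padDeltaCubeY i c par S U)) (η : ℝ) :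
    ((η ^ 2) • (GpDirY i c par S U).restrictScalars ℝ : Module.End ℝ (SiteY i → 𝔸)) =
      (η ^ 2) • (GinvY i c par S U).restrictScalars ℝ - exMul i S (η ^ 2) := by
  rw [GpDirY_eq_GinvY_sub i c par hU]
  have e : ((GinvY i c par S U - (1 - cubeProjY i S)).restrictScalars ℝ : Module.End ℝ (SiteY i → 𝔸)) =
      (GinvY i c par S U).restrictScalars ℝ - ((1 : Module.End ℂ (SiteY i → 𝔸)) - cubeProjY i S).restrictScalars ℝ := LinearMap.ext fun _ => rfl
  rw [e, smul_sub, restrictScalars_one_sub_cubeProjY, smul_exMul, mul_one]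

/-- ★ **THE LEFT BOUNDARY WORD**: `∇_{U,μ}(η⁻¹)·η²(1 − Ω₀) = ηR(U_μ)σ_μ(1 − Ω₀) − η(1 − Ω₀)`. [cite: Balaban1985BackgroundPropagators, (3.3) p.390, p.394, bookkeeping] -/
theorem diffLetter_inl_mul_exMul (V : CfgY 𝔸 i) (η : ℝ) (μ : Fin (d + 1)) :
    diffLetter (shiftY i) (UboxY i V) (((η : ℂ))⁻¹) (Sum.inl μ) * exMul i S (η ^ 2) =
      rotF i V η μ * (shiftOpY i μ).restrictScalars ℝ * exMul i S 1 - exMul i S η := by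
  refine LinearMap.ext fun f => funext fun z => ?_
  rw [Module.End.mul_apply, diffLetter_inl, gradLetterF_apply, covD, exMul_apply, exMul_apply, LinearMap.sub_apply, Pi.sub_apply, Module.End.mul_apply,
    Module.End.mul_apply, rotF_apply, shiftOpY_rs_apply, exMul_apply, exMul_apply]
  by_cases h1 : shiftY i μ z ∈ S <;> by_cases h2 : z ∈ S <;>
    simp only [h1, h2, if_true, if_false, R_zero, sub_zero, zero_sub, smul_zero, one_smul, smul_sub, smul_neg, R_smul, inv_smul_sq_smul]

/-- ★ **THE RIGHT BOUNDARY WORD**: `η²(1 − Ω₀)·(−∇*_{U,μ})(η⁻¹) = η(1 − Ω₀) − (1 − Ω₀)ηR(U_μ(· − e_μ))⁻¹σ_{−μ}`. [cite: Balaban1985BackgroundPropagators, (3.8) p.392, p.394, bookkeeping] -/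
theorem exMul_mul_diffLetter_inr (V : CfgY 𝔸 i) (η : ℝ) (μ : Fin (d + 1)) :
    exMul i S (η ^ 2) * diffLetter (shiftY i) (UboxY i V) (((η : ℂ))⁻¹) (Sum.inr μ) =
      exMul i S η - exMul i S 1 * rotB i V η μ * (shiftOpY' i μ).restrictScalars ℝ := by
  refine LinearMap.ext fun f => funext fun z => ?_
  rw [Module.End.mul_apply, diffLetter_inr, LinearMap.neg_apply, exMul_apply, Pi.neg_apply, gradLetterB_apply, covDstar, LinearMap.sub_apply, Pi.sub_apply,
    exMul_apply, Module.End.mul_apply, Module.End.mul_apply, exMul_apply, rotB_apply, shiftOpY'_rs_apply]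
  by_cases h2 : z ∈ S
  · simp only [h2, if_true, sub_zero]
  · simp only [h2, if_false, one_smul, smul_neg, smul_sub]
    rw [← Complex.coe_smul (η ^ 2), smul_smul, ← Complex.coe_smul (η ^ 2), smul_smul, ← Complex.coe_smul η, ← Complex.coe_smul η (R _ _)]
    have e : ((η ^ 2 : ℝ) : ℂ) * ((η : ℂ))⁻¹ = (η : ℂ) := by push_cast; field_simp
    rw [e]
    abel

variable (S)

/-- ★ **THE LAPLACIAN PRODUCT**: `Δ_U·G′_□(U) = Ω₀ − Ω₀·(avg)(U)·G′_□(U) + (1 − Ω₀)·Δ_U·G′_□(U)` (E's `Ω₀Δ′_{a,□}(U)G′_□(U) = Ω₀` and `Δ′_{a,□} = Δ_U + avg`).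
[cite: Balaban1985BackgroundPropagators, (3.24)–(3.25) p.394, Thm 3.1 (3.42)₄ p.397] -/
theorem lapSL_mul_GpDirY {U : CfgY 𝔸 i} (hU : IsUnit (padDeltaCubeY i c par S U)) :
    lapSL i U * GpDirY i c par S U =
      cubeProjY i S - cubeProjY i S * avgOpY i c par U * GpDirY i c par S U + (1 - cubeProjY i S) * lapSL i U * GpDirY i c par S U := by
  set P := cubeProjY (𝔸 := 𝔸) i S
  set O := GpDirY i c par S U
  have hE : P * deltaPrimeACubeY i c par U * O = P := cubeProjY_mul_deltaPrimeACubeY_mul_GpDirY i c par hU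
  have hΔ : lapSL i U = deltaPrimeACubeY i c par U - avgOpY i c par U := by rw [deltaPrimeACubeY_eq_add, add_sub_cancel_right]
  have h1 : P * lapSL i U * O = P - P * avgOpY i c par U * O := by rw [hΔ, mul_sub, sub_mul, hE]
  calc lapSL i U * O = P * lapSL i U * O + (1 - P) * lapSL i U * O := by rw [sub_mul, one_mul, sub_mul]; abel
    _ = _ := by rw [h1]

/-- ★ **THE FLUX ACROSS `∂Ω₀(□)`**: on the rows off `Ω₀` (where `G′_□(U)λ` vanishes) the Laplacian of `G′_□(U)λ` is minus the sum of the rotated neighbours —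
`(1 − Ω₀)Δ_U G′_□(U) = −Σ_μ [(1 − Ω₀)R(U_μ(·−e_μ))⁻¹σ_{−μ} + (1 − Ω₀)R(U_μ)σ_μ]·G′_□(U)` (real-linear letters).
[cite: Balaban1985BackgroundPropagators, (3.23) p.394, p.394 (Dirichlet conditions), Thm 3.1 (3.42)₄ p.397] -/
theorem exMul_lapSL_GpDirY (U : CfgY 𝔸 i) :
    (((1 - cubeProjY i S) * lapSL i U * GpDirY i c par S U).restrictScalars ℝ : Module.End ℝ (SiteY i → 𝔸)) =
      -((∑ μ : Fin (d + 1), (exMul i S 1 * rotB i U 1 μ * (shiftOpY' i μ).restrictScalars ℝ + exMul i S 1 * rotF i U 1 μ * (shiftOpY i μ).restrictScalars ℝ)) *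
        (GpDirY i c par S U).restrictScalars ℝ) := by
  refine LinearMap.ext fun f => funext fun z => ?_
  set Φ := GpDirY i c par S U f with hΦ
  have lhs : (((1 - cubeProjY i S) * lapSL i U * GpDirY i c par S U).restrictScalars ℝ : Module.End ℝ (SiteY i → 𝔸)) f z =
      if z ∈ S then 0 else lapS i U Φ z := by
    rw [LinearMap.restrictScalars_apply, Module.End.mul_apply, Module.End.mul_apply, LinearMap.sub_apply, Module.End.one_apply, Pi.sub_apply, cubeProjY_apply,
      lapSL_apply]
    split_ifs
    · exact sub_self _
    · exact sub_zero _
  have rhs : ((-((∑ μ : Fin (d + 1), (exMul i S 1 * rotB i U 1 μ * (shiftOpY' i μ).restrictScalars ℝ + exMul i S 1 * rotF i U 1 μ * (shiftOpY i μ).restrictScalars ℝ)) *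
        (GpDirY i c par S U).restrictScalars ℝ) : Module.End ℝ (SiteY i → 𝔸)) f z) =
      if z ∈ S then 0 else -∑ μ : Fin (d + 1), (R (UboxY i U μ ((shiftY i μ).symm z))⁻¹ (Φ ((shiftY i μ).symm z)) + R (UboxY i U μ z) (Φ (shiftY i μ z))) := by
    rw [LinearMap.neg_apply, Pi.neg_apply, Module.End.mul_apply, LinearMap.restrictScalars_apply, ← hΦ, LinearMap.sum_apply, Finset.sum_apply]
    simp only [LinearMap.add_apply, Pi.add_apply, Module.End.mul_apply, exMul_apply, rotB_apply, rotF_apply, shiftOpY_rs_apply, shiftOpY'_rs_apply, one_smul]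
    by_cases hz : z ∈ S
    · simp only [hz, if_true, add_zero, Finset.sum_const_zero, neg_zero]
    · simp only [hz, if_false]
  rw [lhs, rhs]
  split_ifs with hz
  · rfl
  · have hΦ0 : Φ z = 0 := GpDirY_apply_eq_zero i c par U f hz
    show (∑ μ : Fin (d + 1), cdsS i U μ (cdS i U μ Φ) z) = _
    rw [← Finset.sum_neg_distrib]
    refine Finset.sum_congr rfl fun μ _ => ?_
    rw [lapS_term_apply, hΦ0, add_zero, zero_sub, neg_add, sub_eq_add_neg]

end Algebra

/-! ## §2b  The four (3.42) products of `η²G′_□(U)` after coordinates: padded-inverse word plus boundary words -/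

section Words

variable {ι : Type} [Fintype ι] (b : Module.Basis ι ℝ 𝔸)
variable (i : KIdx d ℓ hd hL b₀ b₁) (c : ↥(cubes (toKT i).D.toDomains)) (par : SiteParY 𝔸 i) {S : Finset (SiteY i)}

omit [CompleteSpace 𝔸] in
/-- `conj b` of a finite sum. [cite: Balaban1984PropagatorsII, (2.51) p.232, bookkeeping] -/
theorem conj_sum {X κ : Type} (T : κ → Module.End ℝ (X → 𝔸)) (s : Finset κ) : conj b (∑ k ∈ s, T k) = ∑ k ∈ s, conj b (T k) :=
  map_sum (coordEquiv b).conj T s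

omit [CompleteSpace 𝔸] in
/-- restriction of scalars is multiplicative (bookkeeping). [cite: Balaban1985BackgroundPropagators, p.394, bookkeeping] -/
theorem rs_mul (A B : Module.End ℂ (SiteY i → 𝔸)) :
    ((A * B).restrictScalars ℝ : Module.End ℝ (SiteY i → 𝔸)) = A.restrictScalars ℝ * B.restrictScalars ℝ := LinearMap.ext fun _ => rfl

/-- ★ **(3.42)₁-WORD**: `conj b(η²G′_□(U)) = conj b(η²(padΔ)⁻¹) − conj b(η²(1 − Ω₀))`. [cite: Balaban1985BackgroundPropagators, Thm 3.1 (3.42)₁ p.397, p.394] -/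
theorem conj_O_eq {U : CfgY 𝔸 i} (hU : IsUnit (padDeltaCubeY i c par S U)) (η : ℝ) :
    conj b ((η ^ 2) • (GpDirY i c par S U).restrictScalars ℝ) = conj b ((η ^ 2) • (GinvY i c par S U).restrictScalars ℝ) - conj b (exMul i S (η ^ 2)) := by
  rw [smul_GpDirY_restrict i c par hU, conj_sub]

/-- ★ **(3.42)₂-WORD**: `conj b(∇_{U,μ})·conj b(η²G′_□(U)) = conj b(∇_{U,μ})·conj b(η²(padΔ)⁻¹) − conj b(ηR(U_μ))·conj b(σ_μ)·conj b(1 − Ω₀) + conj b(η(1 − Ω₀))`.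
[cite: Balaban1985BackgroundPropagators, Thm 3.1 (3.42)₂ p.397, (3.3) p.390, p.394] -/
theorem conj_diffLetter_inl_mul_O_eq {U : CfgY 𝔸 i} (hU : IsUnit (padDeltaCubeY i c par S U)) (V : CfgY 𝔸 i) (η : ℝ) (μ : Fin (d + 1)) :
    conj b (diffLetter (shiftY i) (UboxY i V) (((η : ℂ))⁻¹) (Sum.inl μ)) * conj b ((η ^ 2) • (GpDirY i c par S U).restrictScalars ℝ) =
      conj b (diffLetter (shiftY i) (UboxY i V) (((η : ℂ))⁻¹) (Sum.inl μ)) * conj b ((η ^ 2) • (GinvY i c par S U).restrictScalars ℝ) -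
        conj b (rotF i V η μ) * conj b ((shiftOpY (𝔸 := 𝔸) i μ).restrictScalars ℝ) * conj b (exMul i S 1) + conj b (exMul i S η) := by
  rw [conj_O_eq b i c par hU, mul_sub, ← B9Eq352DivFormLetters.conj_mul b _ (exMul i S (η ^ 2)), diffLetter_inl_mul_exMul, conj_sub,
    B9Eq352DivFormLetters.conj_mul, B9Eq352DivFormLetters.conj_mul]
  abel

/-- ★ **(3.42)₃-WORD**: `conj b(η²G′_□(U))·conj b(−∇*_{U,μ}) = conj b(η²(padΔ)⁻¹)·conj b(−∇*_{U,μ}) − conj b(η(1 − Ω₀)) + conj b(1 − Ω₀)·conj b(ηR(U_μ(·−e_μ))⁻¹)·conj b(σ_{−μ})`.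
[cite: Balaban1985BackgroundPropagators, Thm 3.1 (3.42)₃ p.397, (3.8) p.392, p.394] -/
theorem conj_O_mul_diffLetter_inr_eq {U : CfgY 𝔸 i} (hU : IsUnit (padDeltaCubeY i c par S U)) (V : CfgY 𝔸 i) (η : ℝ) (μ : Fin (d + 1)) :
    conj b ((η ^ 2) • (GpDirY i c par S U).restrictScalars ℝ) * conj b (diffLetter (shiftY i) (UboxY i V) (((η : ℂ))⁻¹) (Sum.inr μ)) =
      conj b ((η ^ 2) • (GinvY i c par S U).restrictScalars ℝ) * conj b (diffLetter (shiftY i) (UboxY i V) (((η : ℂ))⁻¹) (Sum.inr μ)) -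
        conj b (exMul i S η) + conj b (exMul i S 1) * conj b (rotB i V η μ) * conj b ((shiftOpY' (𝔸 := 𝔸) i μ).restrictScalars ℝ) := by
  rw [conj_O_eq b i c par hU, sub_mul, ← B9Eq352DivFormLetters.conj_mul b (exMul i S (η ^ 2)), exMul_mul_diffLetter_inr, conj_sub,
    B9Eq352DivFormLetters.conj_mul, B9Eq352DivFormLetters.conj_mul]
  abel

/-- ★ **(3.42)₄-WORD**: `conj b(η⁻²Δ_U)·conj b(η²G′_□(U)) = conj b(Ω₀) − conj b(Ω₀)·conj b(η⁻²avg(U))·conj b(η²G′_□(U))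
 − Σ_μ [conj b(η⁻²(1 − Ω₀))·conj b(R(U_μ(·−e_μ))⁻¹)·conj b(σ_{−μ}) + conj b(η⁻²(1 − Ω₀))·conj b(R(U_μ))·conj b(σ_μ)]·conj b(η²G′_□(U))` (`η ≠ 0`).
[cite: Balaban1985BackgroundPropagators, Thm 3.1 (3.42)₄ p.397, (3.23)–(3.25) p.394] -/
theorem conj_lapSL_mul_O_eq {U : CfgY 𝔸 i} (hU : IsUnit (padDeltaCubeY i c par S U)) {η : ℝ} (hη : η ≠ 0) :
    conj b ((((η ^ 2)⁻¹ : ℝ)) • (lapSL i U).restrictScalars ℝ) * conj b ((η ^ 2) • (GpDirY i c par S U).restrictScalars ℝ) =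
      conj b ((cubeProjY i S).restrictScalars ℝ) -
        conj b ((cubeProjY i S).restrictScalars ℝ) * conj b ((((η ^ 2)⁻¹ : ℝ)) • (avgOpY i c par U).restrictScalars ℝ) *
          conj b ((η ^ 2) • (GpDirY i c par S U).restrictScalars ℝ) -
        ∑ μ : Fin (d + 1), (conj b (exMul i S ((η ^ 2)⁻¹)) * conj b (rotB i U 1 μ) * conj b ((shiftOpY' (𝔸 := 𝔸) i μ).restrictScalars ℝ) +
            conj b (exMul i S ((η ^ 2)⁻¹)) * conj b (rotF i U 1 μ) * conj b ((shiftOpY (𝔸 := 𝔸) i μ).restrictScalars ℝ)) *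
          conj b ((η ^ 2) • (GpDirY i c par S U).restrictScalars ℝ) := by
  have hη2 : (η ^ 2)⁻¹ * η ^ 2 = 1 := inv_mul_cancel₀ (pow_ne_zero 2 hη)
  -- the scalars cancel in every product `η⁻²X · η²O`
  have hsc : ∀ X : Module.End ℝ (SiteY i → 𝔸), (((η ^ 2)⁻¹ : ℝ) • X) * ((η ^ 2) • (GpDirY i c par S U).restrictScalars ℝ) =
      X * (GpDirY i c par S U).restrictScalars ℝ := fun X => by
    rw [smul_mul_assoc, mul_smul_comm, smul_smul, hη2, one_smul]
  -- move `η⁻²` from the scalar on `O` into `exMul`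
  have e2 : ∀ μ : Fin (d + 1), exMul i S ((η ^ 2)⁻¹) * rotB i U 1 μ * (shiftOpY' (𝔸 := 𝔸) i μ).restrictScalars ℝ +
        exMul i S ((η ^ 2)⁻¹) * rotF i U 1 μ * (shiftOpY (𝔸 := 𝔸) i μ).restrictScalars ℝ =
      ((η ^ 2)⁻¹ : ℝ) • (exMul i S 1 * rotB i U 1 μ * (shiftOpY' (𝔸 := 𝔸) i μ).restrictScalars ℝ +
        exMul i S 1 * rotF i U 1 μ * (shiftOpY (𝔸 := 𝔸) i μ).restrictScalars ℝ) := fun μ => by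
    rw [smul_add, ← smul_mul_assoc, ← smul_mul_assoc, ← smul_mul_assoc, ← smul_mul_assoc, smul_exMul, mul_one]
  have e1 : ((cubeProjY i S - cubeProjY i S * avgOpY i c par U * GpDirY i c par S U + (1 - cubeProjY i S) * lapSL i U * GpDirY i c par S U).restrictScalars ℝ :
        Module.End ℝ (SiteY i → 𝔸)) =
      (cubeProjY i S).restrictScalars ℝ - (cubeProjY i S * avgOpY i c par U * GpDirY i c par S U).restrictScalars ℝ +
        ((1 - cubeProjY i S) * lapSL i U * GpDirY i c par S U).restrictScalars ℝ := LinearMap.ext fun _ => rfl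
  have hlhs : (((η ^ 2)⁻¹ : ℝ) • (lapSL i U).restrictScalars ℝ) * ((η ^ 2) • (GpDirY i c par S U).restrictScalars ℝ) =
      (cubeProjY i S).restrictScalars ℝ -
        (cubeProjY i S).restrictScalars ℝ * ((((η ^ 2)⁻¹ : ℝ)) • (avgOpY i c par U).restrictScalars ℝ) * ((η ^ 2) • (GpDirY i c par S U).restrictScalars ℝ) -
        (∑ μ : Fin (d + 1), (exMul i S ((η ^ 2)⁻¹) * rotB i U 1 μ * (shiftOpY' (𝔸 := 𝔸) i μ).restrictScalars ℝ +
            exMul i S ((η ^ 2)⁻¹) * rotF i U 1 μ * (shiftOpY (𝔸 := 𝔸) i μ).restrictScalars ℝ)) * ((η ^ 2) • (GpDirY i c par S U).restrictScalars ℝ) := by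
    rw [hsc, mul_assoc ((cubeProjY i S).restrictScalars ℝ), hsc, Finset.sum_congr rfl fun μ _ => e2 μ, ← Finset.smul_sum, hsc, ← rs_mul, ← mul_assoc, ← rs_mul,
      ← rs_mul, lapSL_mul_GpDirY i c par S hU, e1, exMul_lapSL_GpDirY i c par S U, ← sub_eq_add_neg]
  have hs : ∑ μ : Fin (d + 1), conj b (exMul i S ((η ^ 2)⁻¹) * rotB i U 1 μ * (shiftOpY' (𝔸 := 𝔸) i μ).restrictScalars ℝ +
        exMul i S ((η ^ 2)⁻¹) * rotF i U 1 μ * (shiftOpY (𝔸 := 𝔸) i μ).restrictScalars ℝ) =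
      ∑ μ : Fin (d + 1), (conj b (exMul i S ((η ^ 2)⁻¹)) * conj b (rotB i U 1 μ) * conj b ((shiftOpY' (𝔸 := 𝔸) i μ).restrictScalars ℝ) +
          conj b (exMul i S ((η ^ 2)⁻¹)) * conj b (rotF i U 1 μ) * conj b ((shiftOpY (𝔸 := 𝔸) i μ).restrictScalars ℝ)) :=
    Finset.sum_congr rfl fun μ _ => by
      rw [conj_add, B9Eq352DivFormLetters.conj_mul, B9Eq352DivFormLetters.conj_mul, B9Eq352DivFormLetters.conj_mul, B9Eq352DivFormLetters.conj_mul]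
  rw [← B9Eq352DivFormLetters.conj_mul, hlhs, conj_sub, conj_sub, B9Eq352DivFormLetters.conj_mul, B9Eq352DivFormLetters.conj_mul,
    B9Eq352DivFormLetters.conj_mul, conj_sum, hs, Finset.sum_mul]

end Words

/-! ## §3  The (3.70)-defect multipliers row by row: `5α₁(Lⁿη)⁻¹` on the bonds where `U = e^{iηA}` is small, `2η⁻¹` on level-`0` rows; the averaging operator at the
knit legs does not distinguish `Ṽ` from `Uᵘ` -/

section Defect

variable (i : KIdx d ℓ hd hL b₀ b₁) (c : ↥(cubes (toKT i).D.toDomains))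

variable [NormOneClass 𝔸]

/-- ★ **FORWARD DEFECT ON A SMALL BOND**: if `U_μ(z) = e^{iηA′_μ(z)}` with `‖A′_μ(z)‖ ≤ α₁(L^{n(z)}η)⁻¹`, `α₁ ≤ ¼`, then `‖η⁻¹(R(U_μ(z)) − 1)a‖ ≤ 5α₁(L^{n(z)}η)⁻¹‖a‖`
(r05's `norm_mulDefF_apply_le`, freed from the letter `locCfgY`). [cite: Balaban1985BackgroundPropagators, (3.37) p.396, p.403 l.1–9, (3.70) p.404] -/
theorem norm_mulDefF_apply_le_of_fluct {V : CfgY 𝔸 i} {A' : AfldY 𝔸 i} {α₁ : ℝ} (hα₁0 : 0 ≤ α₁) (hα4 : α₁ ≤ 1 / 4) {μ : Fin (d + 1)} {z : SiteY i}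
    (hVz : UboxY i V μ z = fluct (kGeo i).eta A' μ ((boxEquiv i.hN).symm z))
    (hAz : ‖A' μ ((boxEquiv i.hN).symm z)‖ ≤ α₁ * ((geoCK i c).len (blkCubeY i c z))⁻¹) (f : SiteY i → 𝔸) :
    ‖mulDefF i V ((((kGeo i).eta : ℂ))⁻¹) μ f z‖ ≤ 5 * α₁ * ((geoCK i c).len (blkCubeY i c z))⁻¹ * ‖f z‖ := by
  have hη : 0 < (kGeo i).eta := by rw [← geoCK_eta i c]; exact geoCK_eta_pos i c
  have hlen := geoCK_len_pos i c (blkCubeY i c z)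
  have hηlen : (kGeo i).eta ≤ (geoCK i c).len (blkCubeY i c z) := by rw [← geoCK_eta i c]; exact geoCK_eta_le_len i c _
  set x : ℝ := (kGeo i).eta * (α₁ * ((geoCK i c).len (blkCubeY i c z))⁻¹) with hxdef
  have hx0 : 0 ≤ x := mul_nonneg hη.le (mul_nonneg hα₁0 (inv_nonneg.2 hlen.le))
  have hx4 : x ≤ 1 / 4 := by
    have h1 : (kGeo i).eta * ((geoCK i c).len (blkCubeY i c z))⁻¹ ≤ 1 := by
      rw [← div_eq_mul_inv, div_le_one hlen]; exact hηlen
    calc x = α₁ * ((kGeo i).eta * ((geoCK i c).len (blkCubeY i c z))⁻¹) := by rw [hxdef]; ring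
      _ ≤ α₁ * 1 := mul_le_mul_of_nonneg_left h1 hα₁0
      _ ≤ 1 / 4 := by linarith
  have hxA : (kGeo i).eta * ‖A' μ ((boxEquiv i.hN).symm z)‖ ≤ x := by rw [hxdef]; exact mul_le_mul_of_nonneg_left hAz hη.le
  obtain ⟨h1, h2⟩ := B9Eq358TaxiLettersY.norm_fluct_sub_one_le i hη.le A' μ ((boxEquiv i.hN).symm z) hxA hx4
  rw [mulDefF_apply, norm_smul, norm_inv, Complex.norm_real, Real.norm_eq_abs, abs_of_pos hη, hVz]
  calc (kGeo i).eta⁻¹ * ‖R (fluct (kGeo i).eta A' μ ((boxEquiv i.hN).symm z)) (f z) - f z‖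
      ≤ (kGeo i).eta⁻¹ * (5 * x * ‖f z‖) := mul_le_mul_of_nonneg_left (norm_R_sub_self_le_of_small _ hx0 hx4 h1 h2 (f z)) (inv_nonneg.2 hη.le)
    _ = ((kGeo i).eta⁻¹ * (kGeo i).eta) * (5 * α₁ * ((geoCK i c).len (blkCubeY i c z))⁻¹ * ‖f z‖) := by rw [hxdef]; ring
    _ = 5 * α₁ * ((geoCK i c).len (blkCubeY i c z))⁻¹ * ‖f z‖ := by rw [inv_mul_cancel₀ hη.ne', one_mul]

/-- ★ **BACKWARD DEFECT ON A SMALL BOND** (`U_μ(z − e_μ) = e^{iηA′_μ(z−e_μ)}`, `‖A′_μ(z − e_μ)‖ ≤ α₁(L^{n(z)}η)⁻¹`).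
[cite: Balaban1985BackgroundPropagators, (3.37) p.396, p.403 l.1–9, (3.8) p.392] -/
theorem norm_mulDefB_apply_le_of_fluct {V : CfgY 𝔸 i} {A' : AfldY 𝔸 i} {α₁ : ℝ} (hα₁0 : 0 ≤ α₁) (hα4 : α₁ ≤ 1 / 4) {μ : Fin (d + 1)} {z : SiteY i}
    (hVz : UboxY i V μ ((shiftY i μ).symm z) = fluct (kGeo i).eta A' μ ((boxEquiv i.hN).symm ((shiftY i μ).symm z)))
    (hAz : ‖A' μ ((boxEquiv i.hN).symm ((shiftY i μ).symm z))‖ ≤ α₁ * ((geoCK i c).len (blkCubeY i c z))⁻¹) (f : SiteY i → 𝔸) :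
    ‖mulDefB i V ((((kGeo i).eta : ℂ))⁻¹) μ f z‖ ≤ 5 * α₁ * ((geoCK i c).len (blkCubeY i c z))⁻¹ * ‖f z‖ := by
  have hη : 0 < (kGeo i).eta := by rw [← geoCK_eta i c]; exact geoCK_eta_pos i c
  have hlen := geoCK_len_pos i c (blkCubeY i c z)
  have hηlen : (kGeo i).eta ≤ (geoCK i c).len (blkCubeY i c z) := by rw [← geoCK_eta i c]; exact geoCK_eta_le_len i c _
  set x : ℝ := (kGeo i).eta * (α₁ * ((geoCK i c).len (blkCubeY i c z))⁻¹) with hxdef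
  have hx0 : 0 ≤ x := mul_nonneg hη.le (mul_nonneg hα₁0 (inv_nonneg.2 hlen.le))
  have hx4 : x ≤ 1 / 4 := by
    have h1 : (kGeo i).eta * ((geoCK i c).len (blkCubeY i c z))⁻¹ ≤ 1 := by
      rw [← div_eq_mul_inv, div_le_one hlen]; exact hηlen
    calc x = α₁ * ((kGeo i).eta * ((geoCK i c).len (blkCubeY i c z))⁻¹) := by rw [hxdef]; ring
      _ ≤ α₁ * 1 := mul_le_mul_of_nonneg_left h1 hα₁0
      _ ≤ 1 / 4 := by linarith
  set v := (boxEquiv i.hN).symm ((shiftY i μ).symm z) with hv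
  have hxA : (kGeo i).eta * ‖A' μ v‖ ≤ x := by rw [hxdef]; exact mul_le_mul_of_nonneg_left hAz hη.le
  obtain ⟨h1, h2⟩ := B9Eq358TaxiLettersY.norm_fluct_sub_one_le i hη.le A' μ v hxA hx4
  rw [mulDefB_apply, norm_smul, norm_inv, Complex.norm_real, Real.norm_eq_abs, abs_of_pos hη, hVz]
  have h2' : ‖(((fluct (kGeo i).eta A' μ v)⁻¹ : 𝔸ˣ) : 𝔸) - 1‖ ≤ 2 * x := h2
  have h1' : ‖((((fluct (kGeo i).eta A' μ v)⁻¹)⁻¹ : 𝔸ˣ) : 𝔸) - 1‖ ≤ 2 * x := by rw [inv_inv]; exact h1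
  calc (kGeo i).eta⁻¹ * ‖R (fluct (kGeo i).eta A' μ v)⁻¹ (f z) - f z‖
      ≤ (kGeo i).eta⁻¹ * (5 * x * ‖f z‖) := mul_le_mul_of_nonneg_left (norm_R_sub_self_le_of_small _ hx0 hx4 h2' h1' (f z)) (inv_nonneg.2 hη.le)
    _ = ((kGeo i).eta⁻¹ * (kGeo i).eta) * (5 * α₁ * ((geoCK i c).len (blkCubeY i c z))⁻¹ * ‖f z‖) := by rw [hxdef]; ring
    _ = 5 * α₁ * ((geoCK i c).len (blkCubeY i c z))⁻¹ * ‖f z‖ := by rw [inv_mul_cancel₀ hη.ne', one_mul]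

omit [NormOneClass 𝔸] in
/-- ★ **FORWARD DEFECT ON A LEVEL-`0` ROW**: `‖η⁻¹(R(U_μ(z)) − 1)a‖ ≤ 2η⁻¹‖a‖ = 2(L^{0}η)⁻¹‖a‖` for a contractive rotation.
[cite: Balaban1985BackgroundPropagators, p.403 l.1–9, (3.41) p.397 (`L⁰η = η`), (3.35) p.396 (G-valued)] -/
theorem norm_mulDefF_apply_le_of_lev_zero {V : CfgY 𝔸 i} {μ : Fin (d + 1)} {z : SiteY i} (hR : ∀ a : 𝔸, ‖R (UboxY i V μ z) a‖ ≤ ‖a‖)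
    (h0 : levCubeY i c z = 0) (f : SiteY i → 𝔸) :
    ‖mulDefF i V ((((kGeo i).eta : ℂ))⁻¹) μ f z‖ ≤ 2 * ((geoCK i c).len (blkCubeY i c z))⁻¹ * ‖f z‖ := by
  have hη : 0 < (kGeo i).eta := by rw [← geoCK_eta i c]; exact geoCK_eta_pos i c
  have hlen : (geoCK i c).len (blkCubeY i c z) = (kGeo i).eta := by rw [(geoCK_len_blkCubeY i c z).1, h0, pow_zero, one_mul]
  rw [mulDefF_apply, norm_smul, norm_inv, Complex.norm_real, Real.norm_eq_abs, abs_of_pos hη, hlen]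
  calc (kGeo i).eta⁻¹ * ‖R (UboxY i V μ z) (f z) - f z‖ ≤ (kGeo i).eta⁻¹ * (‖f z‖ + ‖f z‖) :=
        mul_le_mul_of_nonneg_left ((norm_sub_le _ _).trans (add_le_add (hR _) le_rfl)) (inv_nonneg.2 hη.le)
    _ = 2 * (kGeo i).eta⁻¹ * ‖f z‖ := by ring

omit [NormOneClass 𝔸] in
/-- ★ **BACKWARD DEFECT ON A LEVEL-`0` ROW**: `‖η⁻¹(R(U_μ(z − e_μ))⁻¹ − 1)a‖ ≤ 2(L^{0}η)⁻¹‖a‖`. [cite: Balaban1985BackgroundPropagators, p.403 l.1–9, (3.8) p.392, (3.41) p.397] -/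
theorem norm_mulDefB_apply_le_of_lev_zero {V : CfgY 𝔸 i} {μ : Fin (d + 1)} {z : SiteY i} (hR : ∀ a : 𝔸, ‖R (UboxY i V μ ((shiftY i μ).symm z))⁻¹ a‖ ≤ ‖a‖)
    (h0 : levCubeY i c z = 0) (f : SiteY i → 𝔸) :
    ‖mulDefB i V ((((kGeo i).eta : ℂ))⁻¹) μ f z‖ ≤ 2 * ((geoCK i c).len (blkCubeY i c z))⁻¹ * ‖f z‖ := by
  have hη : 0 < (kGeo i).eta := by rw [← geoCK_eta i c]; exact geoCK_eta_pos i c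
  have hlen : (geoCK i c).len (blkCubeY i c z) = (kGeo i).eta := by rw [(geoCK_len_blkCubeY i c z).1, h0, pow_zero, one_mul]
  rw [mulDefB_apply, norm_smul, norm_inv, Complex.norm_real, Real.norm_eq_abs, abs_of_pos hη, hlen]
  calc (kGeo i).eta⁻¹ * ‖R (UboxY i V μ ((shiftY i μ).symm z))⁻¹ (f z) - f z‖ ≤ (kGeo i).eta⁻¹ * (‖f z‖ + ‖f z‖) :=
        mul_le_mul_of_nonneg_left ((norm_sub_le _ _).trans (add_le_add (hR _) le_rfl)) (inv_nonneg.2 hη.le)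
    _ = 2 * (kGeo i).eta⁻¹ * ‖f z‖ := by ring

/-- ★★ **THE FORWARD DEFECT OF `Uᵘ` IS `≤ 2(L^{n}η)⁻¹` ON EVERY ROW** when `Uᵘ = e^{iηA}` with the (3.37) reading on the bonds inside `S` and `S` contains the positive-level
rows together with their forward neighbours (print's collars): small bonds give `5α₁ ≤ 5/4`, the others are level-`0` rows.
[cite: Balaban1985BackgroundPropagators, (3.37) p.396, p.403 l.1–9, p.408 («Ω₀(□) ⊃ Ω₁(□)»), (3.35) p.396] -/
theorem norm_mulDefF_apply_le_two {V : CfgY 𝔸 i} {S : Finset (SiteY i)} {A : AfldY 𝔸 i} {α₁ : ℝ} (hα₁0 : 0 ≤ α₁) (hα4 : α₁ ≤ 1 / 4) {μ : Fin (d + 1)}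
    (hS : ∀ z : SiteY i, 1 ≤ levCubeY i c z → z ∈ S ∧ shiftY i μ z ∈ S)
    (hV : ∀ z : SiteY i, z ∈ S → shiftY i μ z ∈ S → UboxY i V μ z = fluct (kGeo i).eta A μ ((boxEquiv i.hN).symm z))
    (hA : ∀ z : SiteY i, z ∈ S → shiftY i μ z ∈ S → ‖A μ ((boxEquiv i.hN).symm z)‖ ≤ α₁ * ((geoCK i c).len (blkCubeY i c z))⁻¹)
    (hR : ∀ (z : SiteY i) (a : 𝔸), ‖R (UboxY i V μ z) a‖ ≤ ‖a‖) (f : SiteY i → 𝔸) (z : SiteY i) :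
    ‖mulDefF i V ((((kGeo i).eta : ℂ))⁻¹) μ f z‖ ≤ 2 * ((geoCK i c).len (blkCubeY i c z))⁻¹ * ‖f z‖ := by
  by_cases h : z ∈ S ∧ shiftY i μ z ∈ S
  · refine (norm_mulDefF_apply_le_of_fluct i c hα₁0 hα4 (hV z h.1 h.2) (hA z h.1 h.2) f).trans (mul_le_mul_of_nonneg_right ?_ (norm_nonneg _))
    exact mul_le_mul_of_nonneg_right (by linarith) (inv_nonneg.2 (geoCK_len_pos i c _).le)
  · have h0 : levCubeY i c z = 0 := by
      by_contra hne
      exact h (hS z (Nat.one_le_iff_ne_zero.2 hne))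
    exact norm_mulDefF_apply_le_of_lev_zero i c (hR z) h0 f

/-- ★★ **THE BACKWARD DEFECT OF `Uᵘ` IS `≤ 2(L^{n}η)⁻¹` ON EVERY ROW** (the bond `(z − e_μ, z)`; `S` contains the positive-level rows with their backward neighbours).
[cite: Balaban1985BackgroundPropagators, (3.37) p.396, p.403 l.1–9, (3.8) p.392, p.408] -/
theorem norm_mulDefB_apply_le_two {V : CfgY 𝔸 i} {S : Finset (SiteY i)} {A : AfldY 𝔸 i} {α₁ : ℝ} (hα₁0 : 0 ≤ α₁) (hα4 : α₁ ≤ 1 / 4) {μ : Fin (d + 1)}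
    (hS : ∀ z : SiteY i, 1 ≤ levCubeY i c z → (shiftY i μ).symm z ∈ S ∧ z ∈ S)
    (hV : ∀ w : SiteY i, w ∈ S → shiftY i μ w ∈ S → UboxY i V μ w = fluct (kGeo i).eta A μ ((boxEquiv i.hN).symm w))
    (hA : ∀ z : SiteY i, (shiftY i μ).symm z ∈ S → z ∈ S → ‖A μ ((boxEquiv i.hN).symm ((shiftY i μ).symm z))‖ ≤ α₁ * ((geoCK i c).len (blkCubeY i c z))⁻¹)
    (hR : ∀ (w : SiteY i) (a : 𝔸), ‖R (UboxY i V μ w)⁻¹ a‖ ≤ ‖a‖) (f : SiteY i → 𝔸) (z : SiteY i) :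
    ‖mulDefB i V ((((kGeo i).eta : ℂ))⁻¹) μ f z‖ ≤ 2 * ((geoCK i c).len (blkCubeY i c z))⁻¹ * ‖f z‖ := by
  by_cases h : (shiftY i μ).symm z ∈ S ∧ z ∈ S
  · have hVz := hV ((shiftY i μ).symm z) h.1 (by rw [Equiv.apply_symm_apply]; exact h.2)
    refine (norm_mulDefB_apply_le_of_fluct i c hα₁0 hα4 hVz (hA z h.1 h.2) f).trans (mul_le_mul_of_nonneg_right ?_ (norm_nonneg _))
    exact mul_le_mul_of_nonneg_right (by linarith) (inv_nonneg.2 (geoCK_len_pos i c _).le)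
  · have h0 : levCubeY i c z = 0 := by
      by_contra hne
      exact h (hS z (Nat.one_le_iff_ne_zero.2 hne))
    exact norm_mulDefB_apply_le_of_lev_zero i c (hR _) h0 f

omit [CompleteSpace 𝔸] [NormOneClass 𝔸] in
/-- a transported kernel operator depends on the transporters only on the support of the kernel. [cite: Balaban1985BackgroundPropagators, (3.19) p.393, (3.24) p.394, bookkeeping] -/
theorem kernelTrOpY_congr {X : Type} [Fintype X] {K : X → X → ℝ} {T T' : X → X → 𝔸ˣ} (h : ∀ z w, K z w ≠ 0 → T z w = T' z w) :
    kernelTrOpY (𝔸 := 𝔸) K T = kernelTrOpY K T' := by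
  refine LinearMap.ext fun f => funext fun z => ?_
  rw [kernelTrOpY_apply, kernelTrOpY_apply]
  refine Finset.sum_congr rfl fun w _ => ?_
  by_cases hK : K z w = 0
  · rw [hK, Complex.ofReal_zero, zero_smul, zero_smul]
  · rw [h z w hK]

omit [NormOneClass 𝔸] in
/-- ★ **THE AVERAGING TRANSPORTERS AT THE KNIT LEGS DO NOT DISTINGUISH `Ṽ` FROM `Uᵘ`**: on the support of the (3.24) coefficient (same cube block) a positive-level pair has
its knit bonds inside `S` where `Ṽ = Uᵘ`, a level-`0` pair has trivial legs. [cite: Balaban1985BackgroundPropagators, (3.19) p.393, (3.24) p.394, p.408, Cor. 3.6 p.408] -/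
theorem avgTrCubeY_cutCfgS_eq_gaugeY {S : Finset (SiteY i)} (hS1 : ∀ z : SiteY i, 1 ≤ levCubeY i c z → z ∈ S) {η : ℝ} {A : AfldY 𝔸 i} {g : GaugeY 𝔸 i}
    {U : CfgY 𝔸 i} {Q : Set (Site (PV d ℓ i.m i.K hd hL) 0)} (hQ : ∀ z ∈ S, (boxEquiv i.hN).symm z ∈ Q)
    (hgA : ∀ (κ : Fin (d + 1)) (x : Site (PV d ℓ i.m i.K hd hL) 0), x ∈ Q → x.shift κ ∈ Q → gaugeY i g U κ x = fluct η A κ x)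
    {z w : SiteY i} (hzw : avgCoeffCubeY i c z w ≠ 0) :
    avgTrCubeY i c (parKnitCubeY i c) (cutCfgS i S η A) z w = avgTrCubeY i c (parKnitCubeY i c) (gaugeY i g U) z w := by
  rcases Nat.eq_zero_or_pos (levCubeY i c z) with h0 | hpos
  · have hb := blkCubeY_eq_of_avgCoeffCubeY_ne_zero i c hzw
    have hw0 : levCubeY i c w = 0 := (levCubeY_eq_of_blkOf_eq i c hb).trans h0
    rw [avgTrCubeY_parKnitCubeY i c _ hzw, avgTrCubeY_parKnitCubeY i c _ hzw, knitCubeY_of_levCubeY_eq_zero i c _ h0, knitCubeY_of_levCubeY_eq_zero i c _ h0,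
      knitCubeY_of_levCubeY_eq_zero i c _ hw0, knitCubeY_of_levCubeY_eq_zero i c _ hw0]
  · refine avgTrCubeY_parKnitCubeY_congr_of_agree_block i c hzw fun v μ hv hv' => ?_
    have hvS : v ∈ S := hS1 v (by rw [levCubeY_eq_of_blkOf_eq i c hv]; exact hpos)
    have hv'S : shiftY i μ v ∈ S := hS1 _ (by rw [levCubeY_eq_of_blkOf_eq i c hv']; exact hpos)
    exact UboxY_cutCfgS_of_mem i hQ hgA hvS hv'S

omit [NormOneClass 𝔸] in
/-- hence the averaging OPERATORS coincide: `avg(Ṽ) = avg(Uᵘ)` at `parKnitCubeY`. [cite: Balaban1985BackgroundPropagators, (3.24) p.394, Cor. 3.6 p.408] -/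
theorem avgOpY_cutCfgS_eq_gaugeY {S : Finset (SiteY i)} (hS1 : ∀ z : SiteY i, 1 ≤ levCubeY i c z → z ∈ S) {η : ℝ} {A : AfldY 𝔸 i} {g : GaugeY 𝔸 i}
    {U : CfgY 𝔸 i} {Q : Set (Site (PV d ℓ i.m i.K hd hL) 0)} (hQ : ∀ z ∈ S, (boxEquiv i.hN).symm z ∈ Q)
    (hgA : ∀ (κ : Fin (d + 1)) (x : Site (PV d ℓ i.m i.K hd hL) 0), x ∈ Q → x.shift κ ∈ Q → gaugeY i g U κ x = fluct η A κ x) :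
    avgOpY i c (parKnitCubeY i c) (cutCfgS i S η A) = avgOpY i c (parKnitCubeY i c) (gaugeY i g U) :=
  kernelTrOpY_congr fun _ _ hzw => avgTrCubeY_cutCfgS_eq_gaugeY i c hS1 hQ hgA hzw

end Defect

end Literature.MathematicalPhysics.QuantumFieldTheory.Balaban1983to89.B9Cor36GpDirBoundaryLetters

end
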